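import Literature.MathematicalPhysics.QuantumFieldTheory.Balaban1983to89.B6GOmegaCriticalV1

/-!
# `Balaban1983to89.B6GOmegaReprV1` — T. Bałaban, *Propagators and renormalization transformations for lattice gauge
# theories. II*, Commun. Math. Phys. **96** (1984) 223–250 [Balaban1984PropagatorsII], Sect. A p. 228: the printed
# representation of the critical configuration with `G(Ω)` — *"A = G(Ω)Q*(QG(Ω)Q*)⁻¹B + G(Ω)Q*(QG(Ω)Q*)⁻¹QG(Ω)∂*∂Ω^cB
# − G(Ω)∂*∂Ω^cB"* — ON THE V1 MULTI-LEVEL TORUS CALCULUS, with the multipliers restricted to the constraints inside `Ω`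
# (*"ω = 0 on Ω^c"*), `(QG(Ω)Q*)⁻¹` CONSTRUCTED, r03's `existsUnique_ELO` / `critical_repr` discharged, and the LOCALITY
# of the minimiser: the part of `HB = GQ*(QGQ*)⁻¹B` on the bonds of `Ω` IS the printed `G(Ω)`-expression

statement-level skeleton of published theorems with citation tags; proofs where landed; nothing here is a claim about the
Yang–Mills mass gap

PDF held: `paper:balaban1984-cmp96-propagators-rt-ii` (journal page = PDF page + 222); p. 228 [PDF 6] read AS AN IMAGE on the
×2 render `run/shared/lean/pub/pub-balaban/b2b-balaban-ref1/pages/1984-cmp96-propagators-rt-II/…-p006-x2.png`.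

CITATION HEADER (lean-in-tree rule).  Cell `lit-balaban`, PHASE-2 proof seat **p21** (gen 6, file 8), B6 fold owner r03,
referee ref-4.  WHAT IS REPRODUCED: SKELETON row **B6.Txt@228**, the representation display and *"(2.35) with G(Ω) instead
of G"* — KIND model instance: r03's abstract `…B6GOmegaCritical.existsUnique_ELO` / `critical_repr` (p246565) with EVERY
hypothesis discharged on the model of gen 5/6 (`…B6SectAVectorModelV1`, `…B6SectACriticalPointV1`, `…B6Eq238LocalInverseV1`,
`…B6GOmegaCriticalV1`).  New definitions with bodies: the interior multiplier space `WIn` (*"ω = 0 on Ω^c"*), its constraint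
maps `QIn`/`QsIn`/`aIn`, the `Ω`-form `deltaAIn` of `Δ_a`, `EIn = (QG(Ω)Q*)⁻¹`.  r03's file is used BY NAME; nothing restated.

PRINT (p. 228, verbatim): *"… Rλ = λ, ω = 0 on Ω^c. … Solving critical point equations for h(A, λ, ω) and denoting
G(Ω) = (Δ_a↾_Ω)⁻¹ = (ΩΔ_aΩ)⁻¹, we get A = G(Ω)Q*(QG(Ω)Q*)⁻¹B + G(Ω)Q*(QG(Ω)Q*)⁻¹QG(Ω)∂*∂Ω^cB − G(Ω)∂*∂Ω^cB. … If B = 0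
outside Ω₁, then the above representation simplifies and we get (2.35) with G(Ω) instead of G."*; and before: *"the
configuration A is fixed outside Ω₁ by the conditions (2.6), thus we should obtain a solution of the problem using operators
chosen arbitrarily there"* (the full p. 228 quotation is in `…B6GOmegaCriticalV1`).

TYPED READING (every choice displayed; none is an objection to print).  Operators = gen 5's (`D : Domains`, `c ≠ 0`, weights
`w > 0`): `Δ_a = deltaAE`, `G = GE`, `(QGQ*)⁻¹ = EE`, `H = B6SectA.hOp GE QsE EE`, `Q = QE`, `Q* = QsE`, `a = aE w`, `R = RE`;
`Ω` any decidable bond set (cut-off `cutB Ω`), `G(Ω) = GOmegaE` (gen 6).  *"ω = 0 on Ω^c"*: the INTERIOR constraints are a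
decidable set `I` of constraint indices with `IsInterior` (`(Q(ΩA))_i = (QA)_i`, `i ∈ I`: their averaging bonds lie in `Ω`)
and `IsExterior` (`(Q(ΩA))_i = 0`, `i ∉ I`: their bonds lie off `Ω`) — for the `Λ₀` constraints `A(b) = B₀(b)` this is `b ∈ Ω`
resp. `b ∉ Ω` (`level_zero_dichotomy`), for the block averages it is the print's *"Ω … a sum of big blocks"* margin; the
multipliers live in `WIn I = {ω : ω_i = 0, i ∉ I}`, `QIn`/`QsIn`/`aIn` are `Q`, `Q*`, `a` seen from `WIn`, `deltaAIn =
∂*∂ + ∂R∂* + Q*_I a Q_I` (same `Ω`-compression as `Δ_a`: `cutB_deltaAIn_eq`).  The exterior field is `X = A − ΩA` (*"Ω^cB"*,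
fixed by (2.6): `exterior_apply_eq`).

WHAT IS PROVED (0 sorry, 0 new named facts; axioms standard).
§1 `QE_apply_of_inside_of_cutB_eq_zero` (interior constraints vanish on exterior fields), `level_zero_dichotomy` (the `Λ₀`
constraints are bond evaluations: interior iff `b ∈ Ω`, exterior iff `b ∉ Ω`), `RE_dsE_eq_zero_of_cutB_eq_zero` (`R∂*X = 0` for
exterior fields: the margin).
§2 `zeroExt`, `WIn`, `QIn`, `QsIn`, `aIn`, `deltaAIn` (defs with bodies), adjointness (`inner_QsIn_left`, `inner_aIn_left`),
supports (`cutB_QsE_sub_zeroExt`, `cutB_QsE_zeroExt`, `cutB_QsIn`, `zeroExt_QE_of_cutB_eq_zero`), the compression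
**`cutB_deltaAIn_eq`** (`ΩΔ_a^I = ΩΔ_a`) and r03's `hG`/`hG'` for `G(Ω)` (`GOmegaE_cutB_deltaAIn_cutB`, `cutB_deltaAIn_GOmegaE`).
§3 **`EIn = (QG(Ω)Q*)⁻¹` CONSTRUCTED** on `WIn` (`inner_qgqIn_pos`, `EIn_comp`, `comp_EIn`).
§4 **`existsUnique_ELO_V1`** (r03's `existsUnique_ELO`: the `Ω`-system has exactly one solution), **`ELO_of_global`**
(a solution of the GLOBAL equations `Δ_aA = Q*ω`, `R∂*A = 0` ((2.21) with `λ = 0`) splits as `ΩA` + exterior part into a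
solution of the `Ω`-system), **`critical_repr_V1`** (`ΩA` = THE PRINTED `G(Ω)`-EXPRESSION), **`hOp_local`** (for `A = HB`),
`hOp_local_of_exterior_zero` (*"(2.35) with G(Ω) instead of G"*), `exterior_apply_eq` (off `Ω` the minimiser is `B₀`, (2.6)).
-/

noncomputable section

open scoped InnerProductSpace

namespace Literature.MathematicalPhysics.QuantumFieldTheory.Balaban1983to89.B6GOmegaReprV1

open LatticeFieldCalculus B6SectADomainsV1 B6SectAZeroModesV1 B6SectAOntoV1 B6SectAOperatorsV1 B6SectAVectorModelV1
  B6SectACriticalPointV1 B6SectAScalarModelV1 B6Eq238LocalInverseV1 B6GOmegaCriticalV1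
open BalabanImbrieJaffe1984to88.BIJ85AxialPropagator411 (BondSpace PlaqSpace)

variable {P : Params} (D : Domains P) (Ω : PBond P 0 → Prop) [DecidablePred Ω]

/-! ## §1. Interior and exterior constraints relative to `Ω`; exterior fields exert no gauge force -/

/-- an interior constraint vanishes on exterior fields (`ΩX = 0`). [cite: Balaban1984PropagatorsII, p.228 (ω = 0 on Ω^c)] -/
theorem QE_apply_of_inside_of_cutB_eq_zero {i : BondIdx D} (hi : ∀ x : BondSpace P, QE D (cutB Ω x) i = QE D x i)
    {X : BondSpace P} (hX : cutB Ω X = 0) : QE D X i = 0 := by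
  rw [← hi, hX, map_zero, PiLp.zero_apply]

/-- **the `Λ₀` constraints `A(b) = B₀(b)` ((2.6), `Q₀ = id`) under the cut-off**: `(Q(ΩA))(b) = (QA)(b)` if `b ∈ Ω`, `= 0` if
`b ∉ Ω` (the dichotomy `IsInterior`/`IsExterior` at level `0`). [cite: Balaban1984PropagatorsII, (2.6) p.224 + (2.20) p.226 + p.228] -/
theorem level_zero_dichotomy (b : PBond P 0) (hb : D.LamBond 0 b) (x : BondSpace P) :
    (Ω b → QE D (cutB Ω x) ⟨⟨⟨0, Nat.succ_pos _⟩, b⟩, hb⟩ = QE D x ⟨⟨⟨0, Nat.succ_pos _⟩, b⟩, hb⟩) ∧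
      (¬ Ω b → QE D (cutB Ω x) ⟨⟨⟨0, Nat.succ_pos _⟩, b⟩, hb⟩ = 0) := by
  have h : ∀ y : BondSpace P, QE D y ⟨⟨⟨0, Nat.succ_pos _⟩, b⟩, hb⟩ = y b := fun y => by
    rw [QE_apply]; rfl
  rw [h, h, cutB_apply]
  exact ⟨fun hΩb => if_pos hΩb, fun hΩb => if_neg hΩb⟩

variable {Ω} in
/-- **exterior fields exert no gauge force: `R∂*X = 0` for `ΩX = 0`** (margin: `∂R` maps into the `Ω`-fields).
[cite: Balaban1984PropagatorsII, p.228 ((2.31), (2.34) for G(Ω))] -/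
theorem RE_dsE_eq_zero_of_cutB_eq_zero (hΩ : IsMargin D Ω) (c : ℝ) {X : BondSpace P} (hX : cutB Ω X = 0) :
    RE D c (dsE c X) = 0 := by
  refine ext_inner_left ℝ fun v => ?_
  rw [inner_zero_right, ← inner_RE_left, ← inner_dE_left, ← cutB_dE_RE D hΩ c v, inner_cutB_left, hX, inner_zero_right]

/-- **the interior constraints `I` do not see the cut-off**: `(Q(ΩA))_i = (QA)_i`, `i ∈ I` (their averaging bonds lie in
`Ω`). [cite: Balaban1984PropagatorsII, p.228 (ω = 0 on Ω^c)] -/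
def IsInterior (I : BondIdx D → Prop) : Prop := ∀ i, I i → ∀ x : BondSpace P, QE D (cutB Ω x) i = QE D x i

/-- **the other constraints vanish on `Ω`-fields**: `(Q(ΩA))_i = 0`, `i ∉ I` (their bonds lie off `Ω`).
[cite: Balaban1984PropagatorsII, p.228 (ω = 0 on Ω^c)] -/
def IsExterior (I : BondIdx D → Prop) : Prop := ∀ i, ¬ I i → ∀ x : BondSpace P, QE D (cutB Ω x) i = 0

/-! ## §2. *"ω = 0 on Ω^c"*: the interior multiplier space and the `Ω`-form of `Δ_a` -/

variable (I : BondIdx D → Prop) [DecidablePred I]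

/-- zero the exterior coordinates of a constraint vector. [cite: Balaban1984PropagatorsII, p.228 (ω = 0 on Ω^c)] -/
def zeroExt : BondIdxSpace D →ₗ[ℝ] BondIdxSpace D := onE (diagFn fun i => if I i then 1 else 0)

/-- componentwise. [cite: Balaban1984PropagatorsII, p.228 (ω = 0 on Ω^c)] -/
@[simp] theorem zeroExt_apply (v : BondIdxSpace D) (i : BondIdx D) : zeroExt D I v i = if I i then v i else 0 := by
  change (if I i then (1 : ℝ) else 0) * v i = _
  split_ifs <;> simp

/-- idempotent. [cite: Balaban1984PropagatorsII, p.228 (ω = 0 on Ω^c)] -/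
theorem zeroExt_zeroExt (v : BondIdxSpace D) : zeroExt D I (zeroExt D I v) = zeroExt D I v :=
  PiLp.ext fun i => by simp only [zeroExt_apply]; split_ifs <;> rfl
/-- symmetric. [cite: Balaban1984PropagatorsII, p.228 (ω = 0 on Ω^c)] -/
theorem inner_zeroExt_left (u v : BondIdxSpace D) : ⟪zeroExt D I u, v⟫_ℝ = ⟪u, zeroExt D I v⟫_ℝ := by
  rw [inner_eq_sum, inner_eq_sum]
  exact Finset.sum_congr rfl fun i _ => by rw [zeroExt_apply, zeroExt_apply]; split_ifs <;> ring

/-- commutes with the (diagonal) weight `a`. [cite: Balaban1984PropagatorsII, (2.18) p.226 + p.228] -/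
theorem zeroExt_aE_comm (w : BondIdx D → ℝ) (v : BondIdxSpace D) : zeroExt D I (aE D w v) = aE D w (zeroExt D I v) :=
  PiLp.ext fun i => by simp only [zeroExt_apply, aE_apply]; split_ifs <;> ring

/-- **the interior multiplier space** `{ω : ω = 0 on Ω^c}` (coordinates off `I` vanish). [cite: Balaban1984PropagatorsII, p.228 (ω = 0 on Ω^c)] -/
abbrev WIn : Submodule ℝ (BondIdxSpace D) := LinearMap.range (zeroExt D I)

/-- elements of `WIn` are their own interior parts. [cite: Balaban1984PropagatorsII, p.228 (ω = 0 on Ω^c)] -/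
theorem zeroExt_coe (ω : ↥(WIn D I)) : zeroExt D I (ω : BondIdxSpace D) = ω := by
  obtain ⟨v, hv⟩ := LinearMap.mem_range.mp ω.2
  rw [← hv, zeroExt_zeroExt]

/-- `Q` seen from the interior constraints: `A ↦ (QA)↾I`. [cite: Balaban1984PropagatorsII, (2.20) p.226 + p.228] -/
def QIn : BondSpace P →ₗ[ℝ] ↥(WIn D I) := (zeroExt D I).rangeRestrict ∘ₗ QE D

/-- coordinates. [cite: Balaban1984PropagatorsII, p.228 (ω = 0 on Ω^c)] -/
@[simp] theorem coe_QIn (x : BondSpace P) : (QIn D I x : BondIdxSpace D) = zeroExt D I (QE D x) := rfl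

/-- `Q*` on the interior multipliers. [cite: Balaban1984PropagatorsII, (2.18) p.226 + p.228] -/
def QsIn : ↥(WIn D I) →ₗ[ℝ] BondSpace P := QsE D ∘ₗ (WIn D I).subtype

/-- unfolding. [cite: Balaban1984PropagatorsII, p.228 (ω = 0 on Ω^c)] -/
@[simp] theorem QsIn_apply (ω : ↥(WIn D I)) : QsIn D I ω = QsE D (ω : BondIdxSpace D) := rfl

/-- the weight `a` on the interior multipliers. [cite: Balaban1984PropagatorsII, (2.18) p.226 + p.228] -/
def aIn (w : BondIdx D → ℝ) : ↥(WIn D I) →ₗ[ℝ] ↥(WIn D I) :=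
  (zeroExt D I).rangeRestrict ∘ₗ aE D w ∘ₗ (WIn D I).subtype

/-- coordinates. [cite: Balaban1984PropagatorsII, p.228 (ω = 0 on Ω^c)] -/
@[simp] theorem coe_aIn (w : BondIdx D → ℝ) (ω : ↥(WIn D I)) :
    (aIn D I w ω : BondIdxSpace D) = zeroExt D I (aE D w ω) := rfl

/-- `⟨Q*_Iω, A⟩ = ⟨ω, Q_IA⟩`. [cite: Balaban1984PropagatorsII, (2.18) p.226 + p.228] -/
theorem inner_QsIn_left (ω : ↥(WIn D I)) (x : BondSpace P) : ⟪QsIn D I ω, x⟫_ℝ = ⟪ω, QIn D I x⟫_ℝ := by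
  rw [Submodule.coe_inner, coe_QIn, QsIn_apply, inner_QsE_left, ← inner_zeroExt_left, zeroExt_coe]

/-- `a` is symmetric on `WIn`. [cite: Balaban1984PropagatorsII, (2.18) p.226 + p.228] -/
theorem inner_aIn_left (w : BondIdx D → ℝ) (ω ω' : ↥(WIn D I)) : ⟪aIn D I w ω, ω'⟫_ℝ = ⟪ω, aIn D I w ω'⟫_ℝ := by
  rw [Submodule.coe_inner, Submodule.coe_inner, coe_aIn, coe_aIn, inner_zeroExt_left, zeroExt_coe, ← inner_zeroExt_left,
    zeroExt_coe, inner_aE_left]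

/-- **`Δ_a` with the interior penalty**: `Δ_a^I = ∂*∂ + ∂R∂* + Q*_I a Q_I` (the `Δ_a` of the `Ω`-Lagrange function, whose
`⟨ΩB, aΩB⟩`, `⟨ω, QA − B⟩` only involve the interior constraints). [cite: Balaban1984PropagatorsII, (2.19) p.226 + p.228] -/
def deltaAIn (c : ℝ) (w : BondIdx D → ℝ) : BondSpace P →ₗ[ℝ] BondSpace P :=
  dcsE c ∘ₗ dcE c + dE c ∘ₗ RE D c ∘ₗ dsE c + QsIn D I ∘ₗ aIn D I w ∘ₗ QIn D I

variable {Ω I}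

/-- exterior constraint vectors act off `Ω`: `ΩQ*(u − u↾I) = 0`. [cite: Balaban1984PropagatorsII, p.228 (ω = 0 on Ω^c)] -/
theorem cutB_QsE_sub_zeroExt (hIc : IsExterior D Ω I) (u : BondIdxSpace D) : cutB Ω (QsE D (u - zeroExt D I u)) = 0 := by
  refine ext_inner_right ℝ fun x => ?_
  rw [inner_cutB_left, inner_QsE_left, inner_zero_left, inner_eq_sum]
  refine Finset.sum_eq_zero fun i _ => ?_
  by_cases hi : I i
  · simp [zeroExt_apply, hi]
  · rw [hIc i hi x, mul_zero]

/-- interior constraint vectors live on `Ω`: `ΩQ*(u↾I) = Q*(u↾I)`. [cite: Balaban1984PropagatorsII, p.228 (ω = 0 on Ω^c)] -/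
theorem cutB_QsE_zeroExt (hI : IsInterior D Ω I) (u : BondIdxSpace D) :
    cutB Ω (QsE D (zeroExt D I u)) = QsE D (zeroExt D I u) := by
  refine ext_inner_right ℝ fun x => ?_
  rw [inner_cutB_left, inner_QsE_left, inner_QsE_left, inner_eq_sum, inner_eq_sum]
  refine Finset.sum_congr rfl fun i _ => ?_
  by_cases hi : I i
  · rw [hI i hi x]
  · simp [zeroExt_apply, hi]

/-- `ΩQ*_Iω = Q*_Iω`. [cite: Balaban1984PropagatorsII, p.228 (ω = 0 on Ω^c)] -/
theorem cutB_QsIn (hI : IsInterior D Ω I) (ω : ↥(WIn D I)) : cutB Ω (QsIn D I ω) = QsIn D I ω := by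
  rw [QsIn_apply, ← zeroExt_coe D I ω]
  exact cutB_QsE_zeroExt D hI _

/-- the interior constraints of an exterior field vanish: `(QX)↾I = 0` for `ΩX = 0`. [cite: Balaban1984PropagatorsII, p.228 (ω = 0 on Ω^c)] -/
theorem zeroExt_QE_of_cutB_eq_zero (hI : IsInterior D Ω I) {X : BondSpace P} (hX : cutB Ω X = 0) :
    zeroExt D I (QE D X) = 0 := PiLp.ext fun i => by
  rw [zeroExt_apply, PiLp.zero_apply]
  split_ifs with hi
  · exact QE_apply_of_inside_of_cutB_eq_zero D Ω (hI i hi) hX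
  · rfl

/-- **the compression `ΩΔ_a^I = ΩΔ_a`** (the exterior penalty acts off `Ω`). [cite: Balaban1984PropagatorsII, (2.19) p.226 + p.228 (G(Ω))] -/
theorem cutB_deltaAIn_eq (hIc : IsExterior D Ω I) (c : ℝ) (w : BondIdx D → ℝ) (z : BondSpace P) :
    cutB Ω (deltaAIn D I c w z) = cutB Ω (deltaAE D c w z) := by
  have hu : (aIn D I w (QIn D I z) : BondIdxSpace D) = zeroExt D I (aE D w (QE D z)) := by
    rw [coe_aIn, coe_QIn, ← zeroExt_aE_comm, zeroExt_zeroExt]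
  have h0 := cutB_QsE_sub_zeroExt D hIc (aE D w (QE D z))
  rw [map_sub, map_sub, sub_eq_zero] at h0
  simp only [deltaAIn, deltaAE_def, LinearMap.add_apply, LinearMap.coe_comp, Function.comp_apply, map_add, QsIn_apply, hu,
    ← h0]

/-- r03's `hG` for `Δ_a^I`: `G(Ω)(Ω(Δ_a^I(Ωy))) = Ωy`. [cite: Balaban1984PropagatorsII, p.228 (G(Ω))] -/
theorem GOmegaE_cutB_deltaAIn_cutB (hIc : IsExterior D Ω I) {c : ℝ} (hc : c ≠ 0) {w : BondIdx D → ℝ} (hw : ∀ i, 0 < w i)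
    (y : BondSpace P) : GOmegaE D hc hw Ω (cutB Ω (deltaAIn D I c w (cutB Ω y))) = cutB Ω y := by
  rw [cutB_deltaAIn_eq D hIc]; exact GOmegaE_cutB_deltaAE_cutB D hc hw Ω y

/-- r03's `hG'` for `Δ_a^I`: `Ω(Δ_a^I(G(Ω)y)) = Ωy`. [cite: Balaban1984PropagatorsII, p.228 (G(Ω))] -/
theorem cutB_deltaAIn_GOmegaE (hIc : IsExterior D Ω I) {c : ℝ} (hc : c ≠ 0) {w : BondIdx D → ℝ} (hw : ∀ i, 0 < w i)
    (y : BondSpace P) : cutB Ω (deltaAIn D I c w (GOmegaE D hc hw Ω y)) = cutB Ω y := by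
  rw [cutB_deltaAIn_eq D hIc]; exact cutB_deltaAE_GOmegaE D hc hw Ω y

/-! ## §3. `(QG(Ω)Q*)⁻¹` on the interior multipliers -/

/-- `Q*_I` is injective (gen 5's `QsE_injective`). [cite: Balaban1984PropagatorsII, p.228 before (2.35)] -/
theorem QsIn_injective : Function.Injective (QsIn D I) := fun _ _ h => Subtype.ext (QsE_injective D h)

variable (Ω I)

/-- **`Q_IG(Ω)Q*_I`** on `WIn`. [cite: Balaban1984PropagatorsII, p.228 ((QG(Ω)Q*)⁻¹)] -/
def qgqIn {c : ℝ} (hc : c ≠ 0) {w : BondIdx D → ℝ} (hw : ∀ i, 0 < w i) : ↥(WIn D I) →ₗ[ℝ] ↥(WIn D I) :=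
  QIn D I ∘ₗ GOmegaE D hc hw Ω ∘ₗ QsIn D I

variable {Ω I}

/-- `⟨ω, Q_IG(Ω)Q*_Iω⟩ = ⟨Q*_Iω, G(Ω)Q*_Iω⟩ > 0` for `ω ≠ 0` (`Q*_Iω` lives on `Ω`). [cite: Balaban1984PropagatorsII, p.228 ((QG(Ω)Q*)⁻¹)] -/
theorem inner_qgqIn_pos (hI : IsInterior D Ω I) {c : ℝ} (hc : c ≠ 0) {w : BondIdx D → ℝ} (hw : ∀ i, 0 < w i)
    {ω : ↥(WIn D I)} (hω : ω ≠ 0) : 0 < ⟪ω, qgqIn D Ω I hc hw ω⟫_ℝ := by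
  have hne : cutB Ω (QsIn D I ω) ≠ 0 := by
    rw [cutB_QsIn D hI]
    exact fun h => hω (QsIn_injective D (by rw [h, map_zero]))
  rw [qgqIn, LinearMap.comp_apply, LinearMap.comp_apply, ← inner_QsIn_left]; exact inner_GOmegaE_pos D hc hw Ω hne

/-- hence injective. [cite: Balaban1984PropagatorsII, p.228 ((QG(Ω)Q*)⁻¹)] -/
theorem qgqIn_injective (hI : IsInterior D Ω I) {c : ℝ} (hc : c ≠ 0) {w : BondIdx D → ℝ} (hw : ∀ i, 0 < w i) :
    Function.Injective (qgqIn D Ω I hc hw) :=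
  (injective_iff_map_eq_zero _).mpr fun ω hω => by
    by_contra hne
    have := inner_qgqIn_pos D hI hc hw hne
    rw [hω, inner_zero_right] at this
    exact lt_irrefl 0 this

/-- **`(QG(Ω)Q*)⁻¹` CONSTRUCTED** on the interior multipliers. [cite: Balaban1984PropagatorsII, p.228 ((QG(Ω)Q*)⁻¹)] -/
def EIn (hI : IsInterior D Ω I) {c : ℝ} (hc : c ≠ 0) {w : BondIdx D → ℝ} (hw : ∀ i, 0 < w i) :
    ↥(WIn D I) →ₗ[ℝ] ↥(WIn D I) :=
  ((LinearEquiv.ofInjectiveEndo (qgqIn D Ω I hc hw) (qgqIn_injective D hI hc hw)).symm : ↥(WIn D I) →ₗ[ℝ] ↥(WIn D I))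

/-- `(QG(Ω)Q*)⁻¹(QG(Ω)Q*) = 1`. [cite: Balaban1984PropagatorsII, p.228 ((QG(Ω)Q*)⁻¹)] -/
theorem EIn_comp (hI : IsInterior D Ω I) {c : ℝ} (hc : c ≠ 0) {w : BondIdx D → ℝ} (hw : ∀ i, 0 < w i) :
    EIn D hI hc hw ∘ₗ (QIn D I ∘ₗ GOmegaE D hc hw Ω ∘ₗ QsIn D I) = LinearMap.id := by
  have h := LinearEquiv.ofInjectiveEndo_left_inv (qgqIn D Ω I hc hw) (qgqIn_injective D hI hc hw)
  rwa [Module.End.mul_eq_comp, Module.End.one_eq_id] at h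

/-- `(QG(Ω)Q*)(QG(Ω)Q*)⁻¹ = 1`. [cite: Balaban1984PropagatorsII, p.228 ((QG(Ω)Q*)⁻¹)] -/
theorem comp_EIn (hI : IsInterior D Ω I) {c : ℝ} (hc : c ≠ 0) {w : BondIdx D → ℝ} (hw : ∀ i, 0 < w i) :
    (QIn D I ∘ₗ GOmegaE D hc hw Ω ∘ₗ QsIn D I) ∘ₗ EIn D hI hc hw = LinearMap.id := by
  have h := LinearEquiv.ofInjectiveEndo_right_inv (qgqIn D Ω I hc hw) (qgqIn_injective D hI hc hw)
  rwa [Module.End.mul_eq_comp, Module.End.one_eq_id] at h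

/-! ## §4. The critical point of the `Ω`-Lagrange function and the locality of the minimiser -/

section Main

variable (hΩ : IsMargin D Ω) (hI : IsInterior D Ω I) (hIc : IsExterior D Ω I)
include hΩ hI hIc

/-- **"exactly one" for the `Ω`-problem ON THE MODEL**: for every `Ω` with the margin, `I` with the dichotomy, exterior field
`X` and interior datum `B`, r03's critical-point system `ELO` (`Rλ = λ`) has exactly one solution — r03's `existsUnique_ELO`
with all twenty hypotheses discharged. [cite: Balaban1984PropagatorsII, p.228 (representation of A with G(Ω))] -/
theorem existsUnique_ELO_V1 {c : ℝ} (hc : c ≠ 0) {w : BondIdx D → ℝ} (hw : ∀ i, 0 < w i) (X : BondSpace P)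
    (B : ↥(WIn D I)) :
    ∃! t : BondSpace P × ScalarSpace P × ↥(WIn D I), RE D c t.2.1 = t.2.1 ∧
      B6GOmegaCritical.ELO (deltaAIn D I c w) (dcE c) (dcsE c) (dE c) (dsE c) (RE D c) (QIn D I) (QsIn D I) (cutB Ω) X B
        t.1 t.2.1 t.2.2 :=
  B6GOmegaCritical.existsUnique_ELO (deltaAIn D I c w) (dcE c) (dcsE c) (aIn D I w) (dE c) (dsE c) (RE D c) (QpE D)
    (QIn D I) (QsIn D I) (cutB Ω) (GOmegaE D hc hw Ω) (EIn D hI hc hw) X B rfl (dcE_comp_dE c)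
    (fun n hn => Subtype.ext (by rw [coe_QIn, QE_dE_eq_zero D c n hn, map_zero, Submodule.coe_zero]))
    (RE_range D c) (RE_fix D c) (fun _ hn => cutB_dE_of_mem_ker D hΩ c hn) (cutB_dE_RE D hΩ c) (inner_dcsE_left c)
    (inner_dE_left c) (inner_RE_left D c) (inner_QsIn_left D I) (inner_cutB_left Ω) (inner_GOmegaE_left D hc hw Ω)
    (LinearMap.ext (GOmegaE_cutB D hc hw Ω)) (LinearMap.ext (cutB_GOmegaE D hc hw Ω)) (LinearMap.ext (cutB_cutB Ω))
    (GOmegaE_cutB_deltaAIn_cutB D hIc hc hw) (cutB_deltaAIn_GOmegaE D hIc hc hw) (EIn_comp D hI hc hw)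
    (comp_EIn D hI hc hw)

/-- **every solution of the GLOBAL equations restricts to a solution of the `Ω`-system**: if `Δ_aA = Q*ω`, `R∂*A = 0`
((2.21) with `λ = 0`), then `x = ΩA`, `λ = 0`, `ω↾I` solve r03's `ELO` with exterior field `X = A − ΩA` and interior datum
`(QA)↾I` (*"… using operators chosen arbitrarily there"*). [cite: Balaban1984PropagatorsII, p.228 (representation of A with G(Ω))] -/
theorem ELO_of_global (c : ℝ) (w : BondIdx D → ℝ) {A : BondSpace P} {ω : BondIdxSpace D}
    (h1 : deltaAE D c w A = QsE D ω) (h2 : RE D c (dsE c A) = 0) :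
    B6GOmegaCritical.ELO (deltaAIn D I c w) (dcE c) (dcsE c) (dE c) (dsE c) (RE D c) (QIn D I) (QsIn D I) (cutB Ω)
      (A - cutB Ω A) (QIn D I A) (cutB Ω A) 0 ((zeroExt D I).rangeRestrict ω) := by
  have hX : cutB Ω (A - cutB Ω A) = 0 := by rw [map_sub, cutB_cutB, sub_self]
  have hsplit : cutB Ω A = A - (A - cutB Ω A) := by rw [sub_sub_cancel]
  have hRX : RE D c (dsE c (A - cutB Ω A)) = 0 := RE_dsE_eq_zero_of_cutB_eq_zero D hΩ c hX
  have hQω : cutB Ω (QsE D ω) = QsE D (zeroExt D I ω) := by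
    have h := cutB_QsE_sub_zeroExt D hIc ω
    rw [map_sub, map_sub, sub_eq_zero] at h
    rw [h, cutB_QsE_zeroExt D hI]
  have hQX : cutB Ω (QsE D (aE D w (QE D (A - cutB Ω A)))) = 0 := by
    have hz : zeroExt D I (aE D w (QE D (A - cutB Ω A))) = 0 := by
      rw [zeroExt_aE_comm, zeroExt_QE_of_cutB_eq_zero D hI hX, map_zero]
    have h := cutB_QsE_sub_zeroExt D hIc (aE D w (QE D (A - cutB Ω A)))
    rwa [hz, sub_zero] at h
  refine ⟨cutB_cutB Ω A, ?_, ?_, ?_⟩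
  · have hcomp : cutB Ω (deltaAIn D I c w (cutB Ω A)) =
        QsE D (zeroExt D I ω) - cutB Ω (dcsE c (dcE c (A - cutB Ω A))) := by
      rw [cutB_deltaAIn_eq D hIc]
      conv_lhs => rw [hsplit]
      rw [map_sub, map_sub, h1, hQω, deltaAE_def]
      simp only [LinearMap.add_apply, LinearMap.coe_comp, Function.comp_apply, map_add, hRX, map_zero, add_zero, hQX]
    rw [map_zero, map_zero, sub_zero, cutB_cutB, hcomp, QsIn_apply]
    change cutB Ω (QsE D (zeroExt D I ω) - cutB Ω (dcsE c (dcE c (A - cutB Ω A))) + cutB Ω (dcsE c (dcE c (A - cutB Ω A)))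
      - QsE D (zeroExt D I ω)) = 0
    rw [sub_add_cancel, sub_self, map_zero]
  · conv_lhs => rw [hsplit]
    rw [map_sub, map_sub, h2, hRX, sub_zero]
  · apply Subtype.ext
    rw [coe_QIn, coe_QIn]
    conv_lhs => rw [hsplit]
    rw [map_sub, map_sub, zeroExt_QE_of_cutB_eq_zero D hI hX, sub_zero]

/-- **THE PRINTED REPRESENTATION ON THE MODEL.**  If `Δ_aA = Q*ω`, `R∂*A = 0`, then with `X = A − ΩA` (the configuration off
`Ω`) and `E = (Q_IG(Ω)Q*_I)⁻¹`:
`ΩA = G(Ω)Q*_I E (QA)↾I + G(Ω)Q*_I E Q_IG(Ω)∂*∂X − G(Ω)∂*∂X`, and `ω↾I = E((QA)↾I + Q_IG(Ω)∂*∂X)` — r03's `critical_repr`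
applied to `ELO_of_global`. [cite: Balaban1984PropagatorsII, p.228 (representation of A with G(Ω))] -/
theorem critical_repr_V1 {c : ℝ} (hc : c ≠ 0) {w : BondIdx D → ℝ} (hw : ∀ i, 0 < w i) {A X : BondSpace P}
    {ω : BondIdxSpace D} (h1 : deltaAE D c w A = QsE D ω) (h2 : RE D c (dsE c A) = 0) (hX : X = A - cutB Ω A) :
    cutB Ω A = B6SectA.hOp (GOmegaE D hc hw Ω) (QsIn D I) (EIn D hI hc hw) (QIn D I A)
        + B6SectA.hOp (GOmegaE D hc hw Ω) (QsIn D I) (EIn D hI hc hw) (QIn D I (GOmegaE D hc hw Ω (dcsE c (dcE c X))))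
        - GOmegaE D hc hw Ω (dcsE c (dcE c X)) ∧
      (zeroExt D I).rangeRestrict ω = EIn D hI hc hw (QIn D I A + QIn D I (GOmegaE D hc hw Ω (dcsE c (dcE c X)))) := by
  subst hX
  obtain ⟨-, hω, hx⟩ := B6GOmegaCritical.critical_repr (deltaAIn D I c w) (dcE c) (dcsE c) (aIn D I w) (dE c) (dsE c)
    (RE D c) (QpE D) (QIn D I) (QsIn D I) (cutB Ω) (GOmegaE D hc hw Ω) (EIn D hI hc hw) (A - cutB Ω A) (QIn D I A) rfl
    (dcE_comp_dE c) (fun n hn => Subtype.ext (by rw [coe_QIn, QE_dE_eq_zero D c n hn, map_zero, Submodule.coe_zero]))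
    (RE_range D c) (fun _ hn => cutB_dE_of_mem_ker D hΩ c hn) (inner_dcsE_left c) (inner_dE_left c) (inner_QsIn_left D I)
    (inner_cutB_left Ω) (LinearMap.ext (GOmegaE_cutB D hc hw Ω)) (GOmegaE_cutB_deltaAIn_cutB D hIc hc hw)
    (EIn_comp D hI hc hw) (map_zero _) (ELO_of_global D hΩ hI hIc c w h1 h2)
  exact ⟨hx, hω⟩

/-- **LOCALITY OF THE MINIMISER `HB = GQ*(QGQ*)⁻¹B` (2.35)**: the part of `HB` on the bonds of `Ω` is the printed
`G(Ω)`-expression in the interior data `B↾I` and the exterior configuration `X = HB − Ω(HB)`: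
`Ω(HB) = G(Ω)Q*_I E B↾I + G(Ω)Q*_I E Q_IG(Ω)∂*∂X − G(Ω)∂*∂X`, `E = (Q_IG(Ω)Q*_I)⁻¹`. [cite: Balaban1984PropagatorsII, p.228 + (2.35)] -/
theorem hOp_local {c : ℝ} (hc : c ≠ 0) {w : BondIdx D → ℝ} (hw : ∀ i, 0 < w i) (B : BondIdxSpace D) {X : BondSpace P}
    (hX : X = B6SectA.hOp (GE D hc hw) (QsE D) (EE D hc hw) B - cutB Ω (B6SectA.hOp (GE D hc hw) (QsE D) (EE D hc hw) B)) :
    cutB Ω (B6SectA.hOp (GE D hc hw) (QsE D) (EE D hc hw) B) =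
      B6SectA.hOp (GOmegaE D hc hw Ω) (QsIn D I) (EIn D hI hc hw) ((zeroExt D I).rangeRestrict B)
        + B6SectA.hOp (GOmegaE D hc hw Ω) (QsIn D I) (EIn D hI hc hw) (QIn D I (GOmegaE D hc hw Ω (dcsE c (dcE c X))))
        - GOmegaE D hc hw Ω (dcsE c (dcE c X)) := by
  subst hX
  have hQ : QE D (B6SectA.hOp (GE D hc hw) (QsE D) (EE D hc hw) B) = B := by
    have := LinearMap.congr_fun (comp_EE D hc hw) B
    simpa [B6SectA.hOp] using this
  have h1 : deltaAE D c w (B6SectA.hOp (GE D hc hw) (QsE D) (EE D hc hw) B) = QsE D (EE D hc hw B) := by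
    simp only [B6SectA.hOp, LinearMap.coe_comp, Function.comp_apply, deltaAE_GE]
  have h2 : RE D c (dsE c (B6SectA.hOp (GE D hc hw) (QsE D) (EE D hc hw) B)) = 0 := by
    have := LinearMap.congr_fun (eq234_left_V1 D hc hw) (EE D hc hw B)
    simpa [B6SectA.hOp] using this
  have hB : QIn D I (B6SectA.hOp (GE D hc hw) (QsE D) (EE D hc hw) B) = (zeroExt D I).rangeRestrict B :=
    Subtype.ext (by rw [coe_QIn, hQ]; rfl)
  have h := (critical_repr_V1 D hΩ hI hIc hc hw h1 h2 rfl).1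
  rwa [hB] at h

/-- ***"If B = 0 outside Ω₁ … we get (2.35) with G(Ω) instead of G"*** ON THE MODEL: when the minimiser vanishes off `Ω`,
`HB = G(Ω)Q*_I(Q_IG(Ω)Q*_I)⁻¹B↾I`. [cite: Balaban1984PropagatorsII, p.228 ((2.35) with G(Ω))] -/
theorem hOp_local_of_exterior_zero {c : ℝ} (hc : c ≠ 0) {w : BondIdx D → ℝ} (hw : ∀ i, 0 < w i) (B : BondIdxSpace D)
    (h0 : cutB Ω (B6SectA.hOp (GE D hc hw) (QsE D) (EE D hc hw) B) = B6SectA.hOp (GE D hc hw) (QsE D) (EE D hc hw) B) :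
    B6SectA.hOp (GE D hc hw) (QsE D) (EE D hc hw) B =
      B6SectA.hOp (GOmegaE D hc hw Ω) (QsIn D I) (EIn D hI hc hw) ((zeroExt D I).rangeRestrict B) := by
  have h := hOp_local D hΩ hI hIc hc hw B rfl
  rw [h0, sub_self, map_zero, map_zero, map_zero, map_zero, map_zero, add_zero, sub_zero] at h
  exact h

end Main

omit [DecidablePred Ω] in
/-- **off `Ω` the minimiser is the datum** ((2.6) *"A = B₀ on Λ₀"*): a bond outside `Ω` is a `Λ₀`-bond (margin) and there
`(HB)(b) = B₀(b)` — the exterior field `X = HB − Ω(HB)` of `hOp_local` is the print's `Ω^cB`. [cite: Balaban1984PropagatorsII, (2.6) p.224 + p.228] -/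
theorem exterior_apply_eq (hΩ : IsMargin D Ω) {c : ℝ} (hc : c ≠ 0) {w : BondIdx D → ℝ} (hw : ∀ i, 0 < w i)
    (B : BondIdxSpace D) {b : PBond P 0} (hb : ¬ Ω b) :
    ∃ hb0 : D.LamBond 0 b, B6SectA.hOp (GE D hc hw) (QsE D) (EE D hc hw) B b = B ⟨⟨⟨0, Nat.succ_pos _⟩, b⟩, hb0⟩ := by
  have hb' : ¬ (NearOm1 D b.src ∨ NearOm1 D b.tgt) := fun h => hb (hΩ b h)
  rw [not_or] at hb'
  have hb0 : D.LamBond 0 b := (D.lamBond_zero_iff b).mpr ⟨fun h => hb'.1 (Or.inl h), fun h => hb'.2 (Or.inl h)⟩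
  refine ⟨hb0, ?_⟩
  have hQ : QE D (B6SectA.hOp (GE D hc hw) (QsE D) (EE D hc hw) B) = B := by
    have := LinearMap.congr_fun (comp_EE D hc hw) B
    simpa [B6SectA.hOp] using this
  have h := congrArg (fun v : BondIdxSpace D => v ⟨⟨⟨0, Nat.succ_pos _⟩, b⟩, hb0⟩) hQ
  simp only [QE_apply] at h
  exact h

end Literature.MathematicalPhysics.QuantumFieldTheory.Balaban1983to89.B6GOmegaReprV1

end
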